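import Summits.CriticalPhenomena.PercolationContinuityZ3.Theorems.SahiLiebSahiContinuum
import Summits.CriticalPhenomena.PercolationContinuityZ3.Theorems.SahiInfiniteVolumePercolation
import Literature.Combinatorics.Sahi2008.LebesgueLevelSets
import Literature.Combinatorics.Sahi2008.FKGCumulation

/-!
# Blinovsky's theorem with two free slots on the unit cube: Lebesgue measure on `[0,1]^d`, every order `n`
# (cell `prim-sahi`, typer seat; `--supports stmt-CriticalPhenomena-4575`)

The finite theorem [Sahi2008, Thm. 2] / [Blinovsky2013] in the cell's sharp form
(`Literature.Combinatorics.Sahi2008.sahiE_nonneg_of_isLatticeCumulation_offTwo`): on a finite distributive lattice with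
an FKG probability weight, `E_n(f_1,…,f_n) ≥ 0` as soon as all but at most two of the nonnegative increasing `f_k` are
cumulations (nonnegative combinations of indicators of principal up-sets).  THIS FILE transports it to LEBESGUE MEASURE
ON `Q_d = [0,1]^d` (every `d`, every `n`) by Lieb–Sahi's discretisation [LiebSahi2021, Lemma 2.3 / 3.8] (tree:
`LebesgueCube.tendsto_gridMoment`) and the measure-level layer cake [LiebSahi2021, Lemma 2.2] (tree:
`msahiE_nonneg_of_levelSets_slotwise`): the continuum cumulations are the nonnegative functions all of whose upper level
sets are principal UP-BOXES `{x | ∀ j, a_j ≤ x_j} = [a_1,1] × ⋯ × [a_d,1]` (or empty).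

* **`msahiE_volume_nonneg_upBoxLevelSets_offTwo`** — Lebesgue measure on `Q_d`, every `n`: `0 ≤ E_n(f_1,…,f_n)`
  whenever the slots `k ∈ J` (`|J| ≤ 2`) hold arbitrary nonnegative increasing functions and the slots `k ∉ J` hold
  nonnegative functions whose upper level sets are principal up-boxes or empty.  NO measurability or boundedness
  hypothesis (monotone functions on `Q_d` are Riemann-sandwiched, as in `LebesgueCube`).
* **`msahiE_volume_nonneg_rectLevelSets_offTwo`** — the reflected form (`x ↦ 1 − x`): two free DECREASING slots,
  the other slots with rectangular upper level sets `[0,r_1] × ⋯ × [0,r_d]` — Lieb–Sahi's Corollary 3.6 (tree: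
  `liebSahi_cor36`, the case `J = ∅`) WITH TWO FREE SLOTS; for `n = 3` and one rectangle slot this is a theorem about
  two arbitrary positive decreasing functions and a rectangle in every dimension `d` (Theorem 2.1 of [LiebSahi2021]
  being the case `d = 2` with three free slots).
* Plumbing of independent use: `isFKGMeasure_cubeWeight` (the uniform weight on `[m+1]^d` is FKG),
  `LebesgueCube.loCube_preimage_upBox` (up-boxes pull back to principal up-sets of the grid, or to `∅`),
  `monotone_of_upBoxLevelSets`, `apply_le_apply_top_of_upBoxLevelSets`.

New mathematics; ingredients [Sahi2008, Thm. 2], [Blinovsky2013], [LiebSahi2021, Lemmas 2.2, 2.3, 3.8].  No conjecture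
enters; no definitions; axioms standard.
-/

namespace Summit.CriticalPhenomena.PercolationContinuityZ3.Theorems

open MeasureTheory Set Filter Topology Literature.Combinatorics.Sahi2008
open Literature.Combinatorics.Sahi2008.LebesgueCube Literature.Probability.LatticeModels
open scoped unitInterval

namespace SahiLebesgueCumulations

variable {d : ℕ}

/-! ### Functions with up-box level sets -/

/-- **A nonnegative function whose upper level sets are principal up-boxes (or empty) is increasing.** [folklore] -/
theorem monotone_of_upBoxLevelSets {φ : (Fin d → I) → ℝ} (h0 : ∀ x, 0 ≤ φ x)
    (hlev : ∀ t : ℝ, 0 ≤ t → (∃ a : Fin d → I, {x | t < φ x} = {x | ∀ j, a j ≤ x j}) ∨ {x | t < φ x} = ∅) :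
    Monotone φ := by
  intro x y hxy
  by_contra hlt
  push Not at hlt
  rcases hlev (φ y) (h0 y) with ⟨a, ha⟩ | hempty
  · have hx : x ∈ ({z | φ y < φ z} : Set (Fin d → I)) := hlt
    rw [ha] at hx
    have hy : y ∈ ({z | ∀ j, a j ≤ z j} : Set (Fin d → I)) := fun j => (hx j).trans (hxy j)
    rw [← ha, Set.mem_setOf_eq] at hy
    exact lt_irrefl _ hy
  · have hx : x ∈ ({z | φ y < φ z} : Set (Fin d → I)) := hlt
    rw [hempty] at hx
    exact hx

/-- **… and bounded by its value at the top corner** `(1,…,1)`. [folklore] -/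
theorem apply_le_apply_top_of_upBoxLevelSets {φ : (Fin d → I) → ℝ} (h0 : ∀ x, 0 ≤ φ x)
    (hlev : ∀ t : ℝ, 0 ≤ t → (∃ a : Fin d → I, {x | t < φ x} = {x | ∀ j, a j ≤ x j}) ∨ {x | t < φ x} = ∅)
    (x : Fin d → I) : φ x ≤ φ fun _ => 1 :=
  monotone_of_upBoxLevelSets h0 hlev fun j => unitInterval.le_one (x j)

/-! ### The grid -/

/-- **The uniform weight on the box `[m+1]^d` is an FKG probability weight** (log-modular). [folklore] -/
theorem isFKGMeasure_cubeWeight (d m : ℕ) : IsFKGMeasure (cubeWeight d m) where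
  nonneg := cubeWeight_nonneg
  sum_eq_one := sum_cubeWeight
  mul_le_mul a b := by simp only [cubeWeight_apply, le_refl]

/-- **Up-boxes pull back to principal up-sets of the grid (or to the empty set)** under the lower-corner map
`loCube m : [m+1]^d → Q_d`. [folklore] -/
theorem loCube_preimage_upBox (m : ℕ) (a : Fin d → I) :
    (∃ b : Fin d → Fin (m + 1), {c : Fin d → Fin (m + 1) | ∀ j, a j ≤ loCube m c j} = {c | b ≤ c}) ∨
      {c : Fin d → Fin (m + 1) | ∀ j, a j ≤ loCube m c j} = ∅ := by
  classical
  -- coordinate `j` of `loCube m c` depends only on `c j`, monotonically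
  have hcoord : ∀ (c : Fin d → Fin (m + 1)) (j : Fin d), loCube m c j = loCube m (fun _ => c j) j :=
    fun c j => rfl
  have hmono1 : ∀ (j : Fin d) (u v : Fin (m + 1)), u ≤ v →
      loCube m (fun _ : Fin d => u) j ≤ loCube m (fun _ => v) j :=
    fun j u v huv => loCube_mono m (fun _ => huv) j
  by_cases hsat : ∀ j, ∃ u : Fin (m + 1), a j ≤ loCube m (fun _ : Fin d => u) j
  · refine Or.inl ?_
    -- the least admissible level in each coordinate
    have hne : ∀ j, (Finset.univ.filter fun u : Fin (m + 1) => a j ≤ loCube m (fun _ : Fin d => u) j).Nonempty :=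
      fun j => by
        obtain ⟨u, hu⟩ := hsat j
        exact ⟨u, Finset.mem_filter.2 ⟨Finset.mem_univ u, hu⟩⟩
    refine ⟨fun j => (Finset.univ.filter fun u : Fin (m + 1) => a j ≤ loCube m (fun _ : Fin d => u) j).min' (hne j),
      Set.ext fun c => ?_⟩
    simp only [Set.mem_setOf_eq]
    constructor
    · intro h j
      exact Finset.min'_le _ _ (Finset.mem_filter.2 ⟨Finset.mem_univ _, (hcoord c j) ▸ h j⟩)
    · intro h j
      have hmem := Finset.min'_mem _ (hne j)
      rw [Finset.mem_filter] at hmem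
      rw [hcoord c j]
      exact hmem.2.trans (hmono1 j _ _ (h j))
  · refine Or.inr (Set.eq_empty_of_forall_notMem fun c hc => hsat fun j => ⟨c j, ?_⟩)
    rw [← hcoord c j]
    exact hc j

/-- Every subset of the (finite) grid is measurable. [folklore] -/
theorem measurableSet_grid {m : ℕ} (A : Set (Fin d → Fin (m + 1))) : MeasurableSet A :=
  A.to_countable.measurableSet

/-! ### The main theorem: two free increasing slots, the others continuum cumulations -/

/-- **Blinovsky's theorem with two free slots, for Lebesgue measure on `[0,1]^d`, every `n`.**  Let `J ⊆ {0,…,n−1}`,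
`|J| ≤ 2`.  If the `f_k`, `k ∈ J`, are arbitrary nonnegative increasing functions on `Q_d` and the `f_k`, `k ∉ J`, are
nonnegative functions all of whose upper level sets `{f_k > t}` (`t ≥ 0`) are principal up-boxes `{x | ∀ j, a_j ≤ x_j}`
or empty, then `0 ≤ E_n(f_0,…,f_{n−1})` for Lebesgue measure.  (Discretise: on the box `[m+1]^d` with its uniform —
FKG — weight the lower-corner family has the same structure, principal up-sets of the grid replacing up-boxes
(`loCube_preimage_upBox`); there the layer cake (`msahiE_nonneg_of_levelSets_slotwise`) and the finite theorem
(`sahiE_nonneg_of_isLatticeCumulation_offTwo`) give `E_n ≥ 0`; let the mesh go to `0` (`tendsto_gridMoment`,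
`continuous_momentE`).) [this work; cite: Sahi2008, Thm. 2; Blinovsky2013; LiebSahi2021, Lemmas 2.2, 2.3, 3.8] -/
theorem msahiE_volume_nonneg_upBoxLevelSets_offTwo {n : ℕ} (J : Finset (Fin n)) (hJ : J.card ≤ 2)
    (f : Fin n → (Fin d → I) → ℝ) (hf0 : ∀ k x, 0 ≤ f k x) (hmono : ∀ k, k ∈ J → Monotone (f k))
    (hlev : ∀ k, k ∉ J → ∀ t : ℝ, 0 ≤ t →
      (∃ a : Fin d → I, {x | t < f k x} = {x | ∀ j, a j ≤ x j}) ∨ {x | t < f k x} = ∅) :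
    0 ≤ msahiE (volume : Measure (Fin d → I)) n f := by
  classical
  -- every slot is increasing, and bounded by its value at the top corner
  have hmono' : ∀ k, Monotone (f k) := fun k => by
    by_cases hk : k ∈ J
    · exact hmono k hk
    · exact monotone_of_upBoxLevelSets (hf0 k) (hlev k hk)
  set B : ℝ := ∑ k, f k fun _ => 1 with hB
  have hbd : ∀ k x, f k x ≤ B := fun k x =>
    (hmono' k fun j => unitInterval.le_one (x j)).trans
      (Finset.single_le_sum (f := fun k => f k fun _ => 1) (fun k _ => hf0 k _) (Finset.mem_univ k))
  -- the limit passage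
  set M : Finset (Fin n) → ℝ := fun S => ∫ x, (∏ i ∈ S, f i) x ∂volume with hM
  have hE : msahiE (volume : Measure (Fin d → I)) n f = momentE n M := msahiE_eq_momentE _ n f
  have hlim : Tendsto (fun m => momentE n fun S => ex (cubeWeight d m) (∏ i ∈ S, gridFam m f i))
      atTop (𝓝 (momentE n M)) :=
    ((continuous_momentE n).tendsto M).comp (tendsto_pi_nhds.2 fun S => tendsto_gridMoment hf0 hmono' S)
  rw [hE]
  refine ge_of_tendsto' hlim fun m => ?_
  rw [← sahiE_eq_momentE, ← msahiE_weightMeasure cubeWeight_nonneg]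
  -- on the grid: slot-dependent classes of level sets
  let 𝒮 : Fin n → Set (Set (Fin d → Fin (m + 1))) := fun k =>
    if k ∈ J then {U | IsUpperSet U} else {A | ∃ b : Fin d → Fin (m + 1), A = {c | b ≤ c}}
  have h𝒮up : ∀ k, ∀ A ∈ 𝒮 k, IsUpperSet A := by
    intro k A hA
    by_cases hk : k ∈ J
    · simp only [𝒮, hk, if_true, Set.mem_setOf_eq] at hA
      exact hA
    · simp only [𝒮, hk, if_false, Set.mem_setOf_eq] at hA
      obtain ⟨b, rfl⟩ := hA
      exact fun _ _ hle hb => hb.trans hle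
  refine msahiE_nonneg_of_levelSets_slotwise (weightMeasure (cubeWeight d m)) 𝒮 (fun k A _ => measurableSet_grid A)
    (fun A hA => ?_) (gridFam m f) (gridFam_nonneg hf0 m) (B := B) (fun k c => hbd k _) fun k t ht => ?_
  · -- indicator families on the grid: the finite theorem
    rw [msahiE_weightMeasure cubeWeight_nonneg]
    have hex : ∀ k, ∃ b : Fin d → Fin (m + 1), k ∉ J → A k = {c | b ≤ c} := by
      intro k
      by_cases hk : k ∈ J
      · exact ⟨fun _ => 0, fun h => absurd hk h⟩
      · have h := hA k
        simp only [𝒮, hk, if_false, Set.mem_setOf_eq] at h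
        obtain ⟨b, h⟩ := h
        exact ⟨b, fun _ => h⟩
    choose b hb using hex
    refine sahiE_nonneg_of_isLatticeCumulation_offTwo (isFKGMeasure_cubeWeight d m) _
      (fun k c => Set.indicator_nonneg (fun _ _ => zero_le_one) c)
      (fun k => SahiInfiniteVolume.monotone_indicator_one_of_isUpperSet (h𝒮up k _ (hA k))) J hJ fun k hk => ?_
    have heq : (A k).indicator (1 : (Fin d → Fin (m + 1)) → ℝ) = setInd (principalUp (b k)) := by
      funext c
      rw [hb k hk, setInd_apply]
      by_cases hc : b k ≤ c
      · rw [if_pos (mem_principalUp.2 hc), Set.indicator_of_mem (show c ∈ {c | b k ≤ c} from hc), Pi.one_apply]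
      · rw [if_neg (fun h => hc (mem_principalUp.1 h)),
          Set.indicator_of_notMem (show c ∉ {c | b k ≤ c} from hc)]
    rw [heq]
    exact isLatticeCumulation_setInd_principalUp (b k)
  · -- level sets of the grid family
    by_cases hk : k ∈ J
    · refine Or.inl ?_
      simp only [𝒮, hk, if_true, Set.mem_setOf_eq]
      exact fun c c' hle hc => lt_of_lt_of_le hc (gridFam_monotone hmono' m k hle)
    · rcases hlev k hk t ht with ⟨a, ha⟩ | hempty
      · have hpre : {c : Fin d → Fin (m + 1) | t < gridFam m f k c} = {c | ∀ j, a j ≤ loCube m c j} := by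
          ext c
          have : loCube m c ∈ {x | t < f k x} ↔ loCube m c ∈ {x : Fin d → I | ∀ j, a j ≤ x j} := by rw [ha]
          exact this
        rcases loCube_preimage_upBox m a with ⟨b, hb⟩ | hemp
        · refine Or.inl ?_
          simp only [𝒮, hk, if_false, Set.mem_setOf_eq]
          exact ⟨b, hpre.trans hb⟩
        · exact Or.inr (hpre.trans hemp)
      · refine Or.inr (Set.eq_empty_of_forall_notMem fun c hc => ?_)
        have : loCube m c ∈ ({x | t < f k x} : Set (Fin d → I)) := hc
        rw [hempty] at this
        exact this

/-! ### The reflected form: two free decreasing slots, the others with rectangular level sets -/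

/-- **Lieb–Sahi's Corollary 3.6 with two free slots, Lebesgue measure on `[0,1]^d`, every `n`.**  If the `f_k`,
`k ∈ J` (`|J| ≤ 2`), are arbitrary nonnegative DECREASING functions on `Q_d` and the `f_k`, `k ∉ J`, are nonnegative
functions all of whose upper level sets are rectangles `[0,r_1] × ⋯ × [0,r_d]` (or empty), then
`0 ≤ E_n(f_0,…,f_{n−1})` for Lebesgue measure (change of variables `x ↦ 1 − x` in
`msahiE_volume_nonneg_upBoxLevelSets_offTwo`).  The case `J = ∅` is [LiebSahi2021, Cor. 3.6] (`liebSahi_cor36`).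
[this work; cite: LiebSahi2021, Cor. 3.6 and §2 (change of variables); Sahi2008, Thm. 2; Blinovsky2013] -/
theorem msahiE_volume_nonneg_rectLevelSets_offTwo {n : ℕ} (J : Finset (Fin n)) (hJ : J.card ≤ 2)
    (f : Fin n → (Fin d → I) → ℝ) (hf0 : ∀ k x, 0 ≤ f k x) (hanti : ∀ k, k ∈ J → Antitone (f k))
    (hlev : ∀ k, k ∉ J → ∀ t : ℝ, 0 ≤ t →
      (∃ r : Fin d → I, {x | t < f k x} = LebesgueBoxes.rect r) ∨ {x | t < f k x} = ∅) :
    0 ≤ msahiE (volume : Measure (Fin d → I)) n f := by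
  set ρ : (Fin d → I) → Fin d → I := fun x j => unitInterval.symm (x j) with hρ
  have hmp : MeasurePreserving ρ volume volume := volume_preserving_pi fun _ => unitInterval.measurePreserving_symm
  have hme : MeasurableEmbedding ρ :=
    (MeasurableEquiv.piCongrRight fun _ : Fin d => unitInterval.symmMeasurableEquiv).measurableEmbedding
  have hρanti : ∀ x y : Fin d → I, x ≤ y → ρ y ≤ ρ x := fun x y hxy j => unitInterval.symm_le_symm.2 (hxy j)
  rw [← msahiE_comp_measurePreserving hmp hme n f]
  refine msahiE_volume_nonneg_upBoxLevelSets_offTwo J hJ _ (fun k x => hf0 k _)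
    (fun k hk x y hxy => hanti k hk (hρanti x y hxy)) fun k hk t ht => ?_
  rcases hlev k hk t ht with ⟨r, hr⟩ | hempty
  · refine Or.inl ⟨fun j => unitInterval.symm (r j), ?_⟩
    ext x
    have h1 : x ∈ ({x | t < (f k ∘ ρ) x} : Set (Fin d → I)) ↔ ρ x ∈ {y | t < f k y} := Iff.rfl
    rw [h1, hr]
    simp only [LebesgueBoxes.rect, Set.mem_setOf_eq, hρ]
    refine forall_congr' fun j => ?_
    conv_lhs => rw [← unitInterval.symm_symm (r j)]
    exact unitInterval.symm_le_symm
  · refine Or.inr (Set.eq_empty_of_forall_notMem fun x hx => ?_)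
    have : ρ x ∈ ({y | t < f k y} : Set (Fin d → I)) := hx
    rw [hempty] at this
    exact this

end SahiLebesgueCumulations

end Summit.CriticalPhenomena.PercolationContinuityZ3.Theorems
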